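import Literature.Barriers.Parity.SiegelZeroDichotomy
import Literature.NumberTheory.LFunctions.ExceptionalZeroOfSmallLOne
import HarnessLib
import Summits.Parity.GeneralizedHardyLittlewood.Theorems.UnboundedSiegelZeros

/-!
# Exceptional characters of a given logarithmic strength (the hypothesis of the illusory sieve)

Statement layer (one parametrised predicate, nothing asserted) plus two proved facts about it.

J. Merikoski, *Exceptional characters and prime numbers in sparse sets*, Algebra & Number Theory 18
(2024) = arXiv:2108.01355, §1, (1.1): "Let `±D` be a fundamental discriminant and let `χ_D(n) = (D/n)`
be the associated primitive real character. We say that `χ_D` is exceptional if `L(1,χ_D)` is very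
small, say, `L(1,χ_D) ≤ log^{−100} D`. It is conjectured that (for a exponent such as 100) there are
at most finitely many exceptional characters … However, assuming that there do exist infinitely many
exceptional characters, it is possible to prove very strong results on distribution of prime numbers"
— Heath-Brown's Siegel-zero twin-prime theorem [HeathBrown1983PrimeTwins], the Friedlander–Iwaniec
illusory sieve for `a² + b⁶` "(with the exponent 100 in (1.1) replaced by 200)"
[FriedlanderIwaniec2005IllusorySieve] and Merikoski's Theorem 1 for `a² + b⁸` (exponent 100). The
exponent varies from source to source (13 in the `x`-normalisation of Friedlander–Iwaniec 2006 as
reported in Zbl 1129.11041; 100; 200), so this file names the HYPOTHESIS with the exponent as a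
parameter:

* `ExceptionalCharactersOfStrength A` — there are primitive quadratic Dirichlet characters `χ (mod q)`
  of arbitrarily large modulus with `‖L(1, χ)‖ ≤ (log q)^{−A}` ("infinitely many exceptional characters
  with exponent `A`"). A DEFINITION (a `Prop`-valued function of `A`), not a claim: every instance is
  expected to be FALSE (it contradicts GRH), exactly like the tree's registered open hypothesis
  `Literature.Barriers.Parity.UnboundedSiegelZeros`, and is used only as the antecedent of conditional
  statements (the obligation `(∀ A, ExceptionalCharactersOfStrength A) → LandauConjecture` of the
  Parity cell's rung route `IllusoryCubeCorner` lives under `Summits/`, not here).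

PROVED here: monotonicity in `A` (`ExceptionalCharactersOfStrength.anti`), and the placement of the
hypothesis on the Siegel-zero branch of the dichotomy — `ExceptionalCharactersOfStrength 3 →
UnboundedSiegelZeros` (`unboundedSiegelZeros_of_exceptionalCharactersOfStrength_three`): by the
tree's Hecke-type converse `Literature.NumberTheory.LFunctions.exists_exceptionalZero_of_norm_LFunction_one_lt`
(`1 − β₁ ≤ K‖L(1,χ)‖` once `‖L(1,χ)‖ < A₀/log²(4q)`), strength `(log q)^{−3}` gives a real zero of
quality `η = 1/((1−β₁) log q) ≥ (log q)²/K → ∞`. Consequently every strength `A ≥ 3`, and a fortiori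
`∀ A`, is refuted by the tree's open statement `NoSiegelZeros` (rh.S34) via
`Literature.Barriers.Parity.not_unboundedSiegelZeros_of_noSiegelZeros`.

Provenance: the predicate and the strength-3 proof were written in the ideation cell `parity-ideate`
(planner seat p1, file `route/bc/LeafSiegelBranch_inline.lean`, 2026-08-25, refereed PASS—KERNEL);
landed by the cell's literature seat with the closed `∀ A` form replaced by the parametrised predicate.

## References
* [Merikoski2024ExceptionalCharacters] J. Merikoski, *Exceptional characters and prime numbers in
  sparse sets*, Algebra Number Theory 18 (2024), arXiv:2108.01355, §1 (1.1) and Theorem 1.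
* [FriedlanderIwaniec2005IllusorySieve] J. Friedlander, H. Iwaniec, *The illusory sieve*, Int. J.
  Number Theory 1 (2005) 459–494, §1.
* [HeathBrown1983PrimeTwins] D. R. Heath-Brown, *Prime twins and Siegel zeros*, Proc. London Math.
  Soc. (3) 47 (1983) 193–224, Theorem 1.
* [MontgomeryVaughan2007] H. L. Montgomery, R. C. Vaughan, *Multiplicative Number Theory I*, CUP 2007,
  Theorems 11.3–11.4 (the converse used, as vendored in `ExceptionalZeroOfSmallLOne.lean`).
-/

noncomputable section

namespace Literature.NumberTheory.LFunctions

open Literature.Barriers.Parity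

/-- **Exceptional characters of strength `A`** (Merikoski's (1.1) with the exponent `100` replaced by
the parameter `A`, "infinitely many" rendered as "of arbitrarily large modulus"): for every `q₀` there
is a primitive quadratic Dirichlet character `χ ≠ 1` modulo some `q ≥ q₀` with
`‖L(1, χ)‖ ≤ (log q)^{−A}`. A hypothesis to argue under (expected false; no instance is asserted
anywhere in the tree). [cite: Merikoski2024ExceptionalCharacters, §1 (1.1) and Theorem 1 (hypothesis)] -/
def ExceptionalCharactersOfStrength (A : ℝ) : Prop :=
  ∀ q₀ : ℕ, ∃ (q : ℕ) (_ : NeZero q) (χ : DirichletCharacter ℂ q),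
    q₀ ≤ q ∧ χ.IsPrimitive ∧ χ ≠ 1 ∧ χ.IsQuadratic ∧ ‖χ.LFunction 1‖ ≤ Real.log q ^ (-A)

/-- A larger exponent is a stronger hypothesis: strength `B` implies strength `A ≤ B` (take the
characters of modulus `≥ 3`, where `log q ≥ 1`). [cite: Merikoski2024ExceptionalCharacters, §1 (the exponent "such as 100" / "replaced by 200")] -/
theorem ExceptionalCharactersOfStrength.anti {A B : ℝ} (hAB : A ≤ B)
    (h : ExceptionalCharactersOfStrength B) : ExceptionalCharactersOfStrength A := by
  intro q₀
  obtain ⟨q, hqne, χ, hq, hprim, hne, hquad, hL⟩ := h (max q₀ 3)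
  have hq₀ : q₀ ≤ q := le_trans (le_max_left _ _) hq
  have hq3 : (3 : ℝ) ≤ q := by exact_mod_cast le_trans (le_max_right _ _) hq
  have hlog1 : 1 ≤ Real.log q := by
    rw [← Real.log_exp 1]
    refine Real.log_le_log (Real.exp_pos 1) (le_trans ?_ hq3)
    have := Real.exp_one_lt_d9
    linarith
  refine ⟨q, hqne, χ, hq₀, hprim, hne, hquad, le_trans hL ?_⟩
  exact Real.rpow_le_rpow_of_exponent_le hlog1 (by linarith)

/-- The closed hypothesis "exceptional characters of EVERY strength" specialises to each strength.
[cite: Merikoski2024ExceptionalCharacters, §1 (1.1)] -/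
theorem ExceptionalCharactersOfStrength.of_forall (h : ∀ A : ℝ, ExceptionalCharactersOfStrength A)
    (A : ℝ) : ExceptionalCharactersOfStrength A := h A

/-- **Exceptional characters of strength 3 give Siegel zeros of unbounded quality** (the tree's
registered open hypothesis `Literature.Barriers.Parity.UnboundedSiegelZeros`): with
`‖L(1,χ)‖ ≤ (log q)^{-3} < A₀/log²(4q)` the converse theorem
`exists_exceptionalZero_of_norm_LFunction_one_lt` yields a real zero `β₁` with
`1 - β₁ ≤ K‖L(1,χ)‖ ≤ K(log q)^{-3}`, i.e. of quality `η = 1/((1-β₁)log q) ≥ (log q)²/K`, which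
exceeds any `η₀` once `q` is large. [cite: MontgomeryVaughan2007, Theorem 11.4 (11.10) (the converse bound 1 - β₁ ≪ L(1,χ))] -/
theorem unboundedSiegelZeros_of_exceptionalCharactersOfStrength_three
    (h : ExceptionalCharactersOfStrength 3) : Summit.Parity.GeneralizedHardyLittlewood.UnboundedSiegelZeros := by
  intro η₀ q₀
  obtain ⟨c, hc, A, hA, K, hK, hH⟩ := exists_exceptionalZero_of_norm_LFunction_one_lt
  -- thresholds: `M` = the quality wanted, `T` < log q
  set M : ℝ := max η₀ 10 with hMdef
  have hM10 : 10 ≤ M := le_max_right _ _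
  have hMη : η₀ ≤ M := le_max_left _ _
  have hMpos : 0 < M := by linarith
  set T : ℝ := max (K * M) (4 / A + 1) with hTdef
  have hTKM : K * M ≤ T := le_max_left _ _
  have hTA : 4 / A + 1 ≤ T := le_max_right _ _
  obtain ⟨q, hqne, χ, hq, hprim, hne, hquad, hL⟩ := h (max q₀ (max 4 (⌈Real.exp T⌉₊ + 1)))
  have hq₀ : q₀ ≤ q := le_trans (le_max_left _ _) hq
  have hq4 : 4 ≤ q := le_trans (le_trans (le_max_left _ _) (le_max_right _ _)) hq
  have hqexp : ⌈Real.exp T⌉₊ + 1 ≤ q := le_trans (le_trans (le_max_right _ _) (le_max_right _ _)) hq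
  have hqR : (4 : ℝ) ≤ q := by exact_mod_cast hq4
  have hqpos : (0 : ℝ) < q := by linarith
  -- `T < log q`, hence `1 < log q`
  have hlogT : T < Real.log q := by
    have h1 : Real.exp T < q := by
      have h2 : ((⌈Real.exp T⌉₊ : ℕ) : ℝ) + 1 ≤ q := by exact_mod_cast hqexp
      linarith [Nat.le_ceil (Real.exp T)]
    calc T = Real.log (Real.exp T) := (Real.log_exp T).symm
      _ < Real.log q := Real.log_lt_log (Real.exp_pos T) h1
  have hA4 : 0 < 4 / A := div_pos (by norm_num) hA
  have hlog1 : 1 < Real.log q := by linarith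
  have hlogpos : 0 < Real.log q := by linarith
  -- `‖L(1,χ)‖ ≤ (log q)^{-3}`
  have hL3 : ‖χ.LFunction 1‖ ≤ 1 / Real.log q ^ 3 := by
    have h3 : Real.log q ^ (-(3 : ℝ)) = 1 / Real.log q ^ 3 := by
      rw [Real.rpow_neg hlogpos.le, show (3 : ℝ) = ((3 : ℕ) : ℝ) by norm_num, Real.rpow_natCast, one_div]
    simpa [h3] using hL
  -- the smallness hypothesis of the converse: `(log q)^{-3} < A/(log 4q)^2` since `log q > 4/A`, `log 4q ≤ 2 log q`
  have hlog4q : Real.log (4 * q) ≤ 2 * Real.log q := by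
    rw [Real.log_mul (by norm_num) hqpos.ne']
    have : Real.log 4 ≤ Real.log q := Real.log_le_log (by norm_num) hqR
    linarith
  have hlog4q_pos : 0 < Real.log (4 * q) := Real.log_pos (by linarith)
  have hsmall : ‖χ.LFunction 1‖ < A / Real.log (4 * q) ^ 2 := by
    have hAlt : 4 < A * Real.log q := by
      have h' : 4 / A < Real.log q := by linarith
      have := (div_lt_iff₀ hA).mp h'
      linarith
    have h1 : 1 / Real.log q ^ 3 < A / (4 * Real.log q ^ 2) := by
      rw [div_lt_div_iff₀ (by positivity) (by positivity)]
      nlinarith [pow_pos hlogpos 2]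
    have h2 : A / (4 * Real.log q ^ 2) ≤ A / Real.log (4 * q) ^ 2 := by
      apply div_le_div_of_nonneg_left hA.le (by positivity)
      nlinarith [hlog4q, hlog4q_pos]
    exact lt_of_le_of_lt hL3 (lt_of_lt_of_le h1 h2)
  haveI : NeZero q := hqne
  obtain ⟨β₁, -, hβ1, hzero, -, -, -, h1β, -⟩ := hH q χ hne hsmall
  have hgap : 0 < 1 - β₁ := by linarith
  -- `(1 - β₁) log q < 1/M`
  have hprod : (1 - β₁) * Real.log q < 1 / M := by
    have hb : 1 - β₁ ≤ K * (1 / Real.log q ^ 3) := le_trans h1β (by gcongr)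
    have hc1 : (1 - β₁) * Real.log q ≤ K / Real.log q ^ 2 := by
      have := mul_le_mul_of_nonneg_right hb hlogpos.le
      have hrw : K * (1 / Real.log q ^ 3) * Real.log q = K / Real.log q ^ 2 := by
        field_simp
      linarith [hrw]
    have hc2 : K / Real.log q ^ 2 < 1 / M := by
      -- `log q ^ 2 ≥ log q > T ≥ K M`, so `K / (log q)^2 < K/(K M) = 1/M`
      have hsq : Real.log q ≤ Real.log q ^ 2 := by nlinarith
      have hKM : K * M < Real.log q ^ 2 := by linarith
      rw [div_lt_div_iff₀ (by positivity) hMpos]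
      nlinarith
    linarith
  -- the quality
  set η : ℝ := 1 / ((1 - β₁) * Real.log q) with hηdef
  have hηprodpos : 0 < (1 - β₁) * Real.log q := mul_pos hgap hlogpos
  have hMη' : M < η := by
    rw [hηdef, lt_one_div hMpos hηprodpos]
    simpa [one_div] using hprod
  have harg : (1 - 1 / (η * Real.log q) : ℝ) = β₁ := by
    rw [hηdef]
    field_simp
    ring
  refine ⟨q, hqne, χ, η, hq₀, le_trans hMη hMη'.le, hprim, hquad, le_trans hM10 hMη'.le, ?_⟩
  rw [harg]
  exact hzero

/-- Hence every strength `A ≥ 3`, and in particular "exceptional characters of every strength",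
yields Siegel zeros of unbounded quality. [cite: MontgomeryVaughan2007, Theorem 11.4 (11.10)] -/
theorem unboundedSiegelZeros_of_exceptionalCharactersOfStrength {A : ℝ} (hA : 3 ≤ A)
    (h : ExceptionalCharactersOfStrength A) : Summit.Parity.GeneralizedHardyLittlewood.UnboundedSiegelZeros :=
  unboundedSiegelZeros_of_exceptionalCharactersOfStrength_three (h.anti hA)

/-- The hypothesis sits on the Siegel-zero branch of the dichotomy: the tree's open no-Siegel-zero
statement `NoSiegelZeros` (rh.S34) refutes every strength `A ≥ 3` (so conditional theorems with this
antecedent hold vacuously under GRH, exactly like `Literature.Barriers.Parity.SiegelZeroTwinPrimes`;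
their content is the unconditional implication). [cite: MontgomeryVaughan2007, Theorem 11.4 (11.10)] -/
theorem not_exceptionalCharactersOfStrength_of_noSiegelZeros (h : NoSiegelZeros) {A : ℝ}
    (hA : 3 ≤ A) : ¬ ExceptionalCharactersOfStrength A := fun hE =>
  not_unboundedSiegelZeros_of_noSiegelZeros h (unboundedSiegelZeros_of_exceptionalCharactersOfStrength hA hE)

end Literature.NumberTheory.LFunctions

end
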